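import Mathlib.Geometry.Manifold.PartitionOfUnity
import Literature.Analysis.FluidPDE.ClassicalSuitable
import Literature.Analysis.FluidPDE.ClassicalSolutionRegion
import HarnessLib

/-!
# Classical solutions on an open space–time region are distributional solutions

Analysis/FluidPDE proofs-layer file (theorems only, no definitions, no named facts).
`ClassicalSuitable.lean` proves that fields which are `C²`/`C¹` on an open **slab** `S × E` and
solve Navier–Stokes pointwise there are distributional (indeed suitable weak) solutions on every
open `Q ⊆ S × E` (`isDistributionalNSSolutionOn_of_contDiffOn`,
`hasWeakSpatialGradientOn_of_contDiffOn`), the integrations by parts being the boundary-free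
whole-space identities of `WholeSpaceIBP`. Local regularity theory works with solutions that
are classical only on an **open space–time region** `O` — parabolic cylinders
`Q_r(z₀) = B_r(x₀) × (t₀ − r², t₀)` (Caffarelli–Kohn–Nirenberg 1982, §1; Seregin 2014, Ch. 6),
the cone of similarity variables, exterior regions — i.e. with the tree's
`IsClassicalNSSolutionOnRegion O ν f u p` (`ClassicalSolutionRegion.lean`), whose fields are
smooth on `O` only. This file supplies the region form:

* `IsClassicalNSSolutionOnRegion.isDistributionalNSSolutionOn` — for `O` open and every open
  `Q ⊆ O`, a classical solution on `O` solves Navier–Stokes in `𝒟'(Q)`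
  (`IsDistributionalNSSolutionOn Q ν f u p`; CKN 1982, (2.2): "if `u` is smooth … (1.1) holds in
  the classical sense" and conversely smooth solutions satisfy (2.2)); no hypothesis on the force
  is needed (on `O` it is the continuous residual `∂ₜu + (u·∇)u − νΔu + ∇p` of the smooth pair);
* `IsClassicalNSSolutionOnRegion.hasWeakSpatialGradientOn` — the classical slice derivative
  `Dₓu` is a weak spatial gradient of `u` on every open `Q ⊆ O` (CKN 1982, (2.1)).

(The suitability of such solutions — the local energy inequality — then follows from the tree's
`isSuitableWeakSolutionOn_of_bounded_of_subset` on relatively compact subregions and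
`IsSuitableWeakSolutionOn.of_exhaustion`; it is not restated here.)

## Proof

The standard cutoff device (Hörmander, *ALPDO I*, §1.4; CKN 1982, §2): a test field `ψ` on `Q`
has compact support `K ⊆ O`; a smooth space–time cutoff `χ ≡ 1` near `K` with compact support
in `O` (`exists_contDiff_tsupport_subset_eventuallyEq_one`, from Mathlib's smooth Urysohn lemma
`exists_contMDiffMap_zero_one_nhds_of_isClosed` and `exists_compact_between`) turns `u`, `p`
into globally smooth, compactly supported fields `ũ = χu`, `p̃ = χp` which agree with `u`, `p`
— together with all their derivatives — on the open set where `χ = 1`, hence satisfy the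
momentum equation near `K` with the original force and are divergence free near `K`. Every
integrand of the weak formulation carries a factor `ψ`, `∂ₜψ`, `Dψ`, `Δψ` or `div ψ`, all
supported in `K`, so the weak integrals of `(u, p, f)` and `(ũ, p̃, f̃)` coincide
(`f̃ :=` the Navier–Stokes residual of `(ũ, p̃)`, continuous, `= f` near `K`). For the globally
smooth fields the slab argument of `ClassicalSuitable.lean` (time set `S = univ`) goes through
verbatim, except that `div ũ = 0` is available only near `K`: in the slice identity the extra
term `∫ (div ũ) ⟪ũ, ψ⟫` of the trilinear identity `integral_inner_convect_add_eq_zero` vanishes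
pointwise (`integral_inner_dt_test_of_momentum_of_divergence_eq_zero`,
`integral_inner_gradient_eq_zero_of_divergence_eq_zero`).

## Mathlib / tree search

Tree: `isDistributionalNSSolutionOn_of_contDiffOn`, `hasWeakSpatialGradientOn_of_contDiffOn`,
`integral_inner_dt_test_of_momentum`, `integral_integral_eq_zero_of_hasDerivAt_time`,
`setIntegral_eq_integral_integral_of_continuousOn`, `continuous_of_continuousOn_of_eq_zero`,
`timeDeriv_eq_zero_off_tsupport`, `notMem_tsupport_slice_of_notMem`,
`IsSpaceTimeTestOn.*` (`ClassicalSuitable`, `ClassicalSolutionCalculus`); `integral_inner_convect_add_eq_zero`,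
`integral_inner_laplacian_comm`, `integral_inner_gradient_eq_neg_integral_mul_divergence`,
`integral_mul_divergence_add_eq_zero_left` (`WholeSpaceIBP`); region predicate and its API
(`ClassicalSolutionRegion`). The smooth cutoff twin `Carleman.exists_smooth_cutoff_nhdsSet`
(`BackwardHeatSubsolution.lean`) and `exists_contDiff_one_nhdsSet_zero_nhdsSet`
(`NSLocalLerayFarFieldTrace.lean`) live behind heavy imports and are re-derived here in 10 lines.
Mathlib: `exists_contMDiffMap_zero_one_nhds_of_isClosed`, `exists_compact_between`,
`contMDiff_iff_contDiff`, `Filter.EventuallyEq.fderiv_eq`, `Filter.EventuallyEq.deriv_eq`,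
`InnerProductSpace.laplacian_congr_nhds`.

## References

* L. Caffarelli, R. Kohn, L. Nirenberg, *Partial regularity of suitable weak solutions of the
  Navier–Stokes equations*, Comm. Pure Appl. Math. 35 (1982), §2, (2.1)–(2.2).
  [CaffarelliKohnNirenberg1982]
* L. Hörmander, *The Analysis of Linear Partial Differential Operators I*, §1.4 (cutoff
  functions). [folklore]
* G. Seregin, *Lecture Notes on Regularity Theory for the Navier–Stokes Equations* (2014),
  Ch. 6 (equations in parabolic cylinders). [Seregin2014]
-/

noncomputable section

open Set Function Filter MeasureTheory TopologicalSpace Metric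
open _root_.Topology
open scoped Laplacian ContDiff InnerProductSpace RealInnerProductSpace ENNReal NNReal Manifold

namespace Literature.Analysis.FluidPDE

/-! ### Smooth space–time cutoffs and localisation of fields -/

section Cutoff

variable {X : Type*} [NormedAddCommGroup X] [NormedSpace ℝ X] [FiniteDimensional ℝ X]
variable {F : Type*} [NormedAddCommGroup F] [NormedSpace ℝ F]

/-- **Smooth cutoff `≡ 1` near a compact set.** For a compact `K` inside an open `O` of a
finite-dimensional real normed space there is a smooth, compactly supported `χ` with
`tsupport χ ⊆ O` and `χ = 1` on a neighbourhood of `K` (smooth Urysohn lemma on the model space: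
Mathlib `exists_contMDiffMap_zero_one_nhds_of_isClosed`, applied to `(interior L)ᶜ` and `K` for a
compact `L ⊆ O` with `K ⊆ interior L`, `exists_compact_between`). Twin of the tree's
`Carleman.exists_smooth_cutoff_nhdsSet` (heavy import closure). [folklore] -/
theorem exists_contDiff_tsupport_subset_eventuallyEq_one {K O : Set X} (hK : IsCompact K)
    (hO : IsOpen O) (hKO : K ⊆ O) :
    ∃ χ : X → ℝ, ContDiff ℝ ∞ χ ∧ HasCompactSupport χ ∧ tsupport χ ⊆ O ∧
      ∀ᶠ z in 𝓝ˢ K, χ z = 1 := by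
  obtain ⟨L, hL, hKL, hLO⟩ := exists_compact_between hK hO hKO
  obtain ⟨f, hf0, hf1, -⟩ :=
    exists_contMDiffMap_zero_one_nhds_of_isClosed (I := 𝓘(ℝ, X)) (M := X) (n := (⊤ : ℕ∞))
      isOpen_interior.isClosed_compl hK.isClosed (disjoint_compl_left_iff_subset.2 hKL)
  have hsupp : support (f : X → ℝ) ⊆ interior L := fun x hx => by
    by_contra hx'
    exact hx (hf0.self_of_nhdsSet x hx')
  have htsupp : tsupport (f : X → ℝ) ⊆ L :=
    (closure_mono hsupp).trans (closure_minimal interior_subset hL.isClosed)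
  exact ⟨f, contMDiff_iff_contDiff.1 f.contMDiff, hL.of_isClosed_subset (isClosed_tsupport _) htsupp,
    htsupp.trans hLO, hf1⟩

omit [FiniteDimensional ℝ X] in
/-- **Localisation is globally smooth.** If `g` is `Cⁿ` on an open set `O` and `χ` is a `Cⁿ`
function with `tsupport χ ⊆ O`, then `χ • g` (with `g` arbitrary off `O`) is `Cⁿ` on the whole
space: near points of `O` it is a product of `Cⁿ` functions, near the other points it vanishes
identically. Twin of `contDiff_smul_of_tsupport_subset` (`EulerTimeDerivDecay.lean`, heavy
import closure). [folklore] -/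
theorem contDiff_cutoff_smul_of_contDiffOn {n : WithTop ℕ∞} {χ : X → ℝ} {g : X → F} {O : Set X}
    (hO : IsOpen O) (hχ : ContDiff ℝ n χ) (hχO : tsupport χ ⊆ O) (hg : ContDiffOn ℝ n g O) :
    ContDiff ℝ n fun z => χ z • g z := by
  rw [contDiff_iff_contDiffAt]
  intro z
  by_cases hz : z ∈ O
  · exact hχ.contDiffAt.smul (hg.contDiffAt (hO.mem_nhds hz))
  · have hz' : z ∉ tsupport χ := fun h => hz (hχO h)
    have h0 : (fun w => χ w • g w) =ᶠ[𝓝 z] fun _ => 0 := by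
      filter_upwards [notMem_tsupport_iff_eventuallyEq.1 hz'] with w hw
      simp [hw]
    exact contDiffAt_const.congr_of_eventuallyEq h0

omit [NormedSpace ℝ X] [FiniteDimensional ℝ X] in
/-- **The localised field has the germ of the original one where `χ ≡ 1`**: on the open set
`interior {χ = 1}` the functions `χ • g` and `g` agree near every point. [folklore] -/
theorem smul_eventuallyEq_of_mem_interior {χ : X → ℝ} {g : X → F} {z : X}
    (hz : z ∈ interior {w | χ w = 1}) : (fun w => χ w • g w) =ᶠ[𝓝 z] g := by
  filter_upwards [mem_interior_iff_mem_nhds.1 hz] with w hw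
  rw [hw, one_smul]

omit [NormedSpace ℝ X] [FiniteDimensional ℝ X] in
/-- A set near which `χ = 1` lies in the open set `interior {χ = 1}`. [folklore] -/
theorem subset_interior_setOf_eq_one {χ : X → ℝ} {K : Set X} (h : ∀ᶠ z in 𝓝ˢ K, χ z = 1) :
    K ⊆ interior {w | χ w = 1} :=
  subset_interior_iff_mem_nhdsSet.2 h

end Cutoff

/-! ### Germs of space–time fields: slices and time lines -/

section Germs

/-- If two space–time fields agree near `(t, x)`, their slices at time `t` agree near `x`.
[folklore] -/
theorem eventuallyEq_slice_of_eventuallyEq_uncurry {E F : Type*} [TopologicalSpace E]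
    {v w : ℝ → E → F} {t : ℝ} {x : E} (h : uncurry v =ᶠ[𝓝 (t, x)] uncurry w) :
    v t =ᶠ[𝓝 x] w t :=
  ((Continuous.prodMk_right t).continuousAt.eventually h).mono fun _ hy => hy

/-- If two space–time fields agree near `(t, x)`, their time lines through `x` agree near `t`.
[folklore] -/
theorem eventuallyEq_timeLine_of_eventuallyEq_uncurry {E F : Type*} [TopologicalSpace E]
    {v w : ℝ → E → F} {t : ℝ} {x : E} (h : uncurry v =ᶠ[𝓝 (t, x)] uncurry w) :
    (fun s => v s x) =ᶠ[𝓝 t] fun s => w s x :=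
  ((Continuous.prodMk_left x).continuousAt.eventually h).mono fun _ hy => hy

/-- Fields agreeing near `(t, x)` have the same time derivative there. [folklore] -/
theorem timeDeriv_congr_of_eventuallyEq {E F : Type*} [TopologicalSpace E]
    [NormedAddCommGroup F] [NormedSpace ℝ F] {v w : ℝ → E → F} {t : ℝ} {x : E}
    (h : uncurry v =ᶠ[𝓝 (t, x)] uncurry w) : timeDeriv v t x = timeDeriv w t x := by
  rw [timeDeriv_apply, timeDeriv_apply, (eventuallyEq_timeLine_of_eventuallyEq_uncurry h).deriv_eq]

/-- Fields agreeing near `(t, x)` have the same slice derivative there. [folklore] -/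
theorem fderiv_slice_congr_of_eventuallyEq {E F : Type*} [NormedAddCommGroup E]
    [NormedSpace ℝ E] [NormedAddCommGroup F] [NormedSpace ℝ F] {v w : ℝ → E → F} {t : ℝ}
    {x : E} (h : uncurry v =ᶠ[𝓝 (t, x)] uncurry w) :
    fderiv ℝ (v t) x = fderiv ℝ (w t) x :=
  (eventuallyEq_slice_of_eventuallyEq_uncurry h).fderiv_eq

/-- The localisation `χ • w` of a space–time field by a space–time cutoff, uncurried. [folklore] -/
theorem uncurry_cutoff_smul {E F : Type*} [SMul ℝ F] (χ : ℝ × E → ℝ) (w : ℝ → E → F) :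
    uncurry (fun t x => χ (t, x) • w t x) = fun z => χ z • uncurry w z := rfl

end Germs


/-! ### Slice identities with the divergence condition only on the support of the test field -/

section Slice

variable {E : Type*} [NormedAddCommGroup E] [InnerProductSpace ℝ E] [FiniteDimensional ℝ E]
  [MeasurableSpace E] [BorelSpace E]
variable {ν : ℝ} {u dtu f : E → E} {p : E → ℝ}

/-- **Weak divergence-free condition, local form.** If `u ∈ C¹(E; E)` has `div u = 0` on the
support of the scalar test function `θ ∈ C¹_c(E)`, then `∫ ⟪u, ∇θ⟫ = 0` (the identity
`∫ θ div u + ∫ ⟪u, ∇θ⟫ = 0` of `WholeSpaceIBP`, whose first integrand vanishes pointwise).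
[cite: CaffarelliKohnNirenberg1982, §2 (2.2)] -/
theorem integral_inner_gradient_eq_zero_of_divergence_eq_zero (hu : ContDiff ℝ 1 u) {θ : E → ℝ}
    (hθ : ContDiff ℝ 1 θ) (hc : HasCompactSupport θ)
    (hdiv : ∀ x ∈ tsupport θ, VectorCalculus.divergence u x = 0) :
    ∫ x, ⟪u x, gradient θ x⟫ = 0 := by
  have h := integral_mul_divergence_add_eq_zero_left hθ hu hc
  have hz : ∫ x, θ x * VectorCalculus.divergence u x = 0 := by
    refine integral_eq_zero_of_ae (Eventually.of_forall fun x => ?_)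
    by_cases hx : x ∈ tsupport θ
    · simp [hdiv x hx]
    · simp [image_eq_zero_of_notMem_tsupport hx]
  linarith

/-- **The momentum equation against a test field, at a fixed time — local form.** As the tree's
`integral_inner_dt_test_of_momentum` (`u ∈ C²(E; E)`, `p ∈ C¹`, `dtu`, `f` continuous with
`dtu + (u·∇)u = νΔu − ∇p + f` pointwise, `ψ ∈ C²_c`), but with `div u = 0` required only on
`tsupport ψ`: `∫ ⟪dtu, ψ⟫ = ∫ (⟪u, (u·∇)ψ⟫ + ν ⟪u, Δψ⟫ + p div ψ + ⟪f, ψ⟫)`. In the trilinear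
identity `∫ ⟪(u·∇)u, ψ⟫ + ∫ ⟪u, (u·∇)ψ⟫ + ∫ (div u)⟪u, ψ⟫ = 0` the last integrand vanishes
pointwise. (The form needed for fields localised by a cutoff, which are divergence free only
where the cutoff is `≡ 1`.) [cite: CaffarelliKohnNirenberg1982, §2 (2.2)] -/
theorem integral_inner_dt_test_of_momentum_of_divergence_eq_zero (hu : ContDiff ℝ 2 u)
    (hp : ContDiff ℝ 1 p) (hdt : Continuous dtu) (hf : Continuous f)
    (hmom : ∀ x, dtu x + convect u u x = ν • (Δ u) x - gradient p x + f x)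
    {ψ : E → E} (hψ : ContDiff ℝ 2 ψ) (hc : HasCompactSupport ψ)
    (hdiv : ∀ x ∈ tsupport ψ, VectorCalculus.divergence u x = 0) :
    ∫ x, ⟪dtu x, ψ x⟫ =
      ∫ x, (⟪u x, convect u ψ x⟫ + ν * ⟪u x, (Δ ψ) x⟫ +
        p x * VectorCalculus.divergence ψ x + ⟪f x, ψ x⟫) := by
  have hu1 : ContDiff ℝ 1 u := hu.of_le one_le_two
  have hψ1 : ContDiff ℝ 1 ψ := hψ.of_le one_le_two
  have huc : Continuous u := hu1.continuous
  have hψc : Continuous ψ := hψ1.continuous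
  -- the force through the equation
  have hf_eq : ∀ x, f x = dtu x + convect u u x - ν • (Δ u) x + gradient p x := fun x => by
    have := hmom x
    rw [eq_comm, ← sub_eq_zero] at this
    rw [← sub_eq_zero, ← this]
    abel
  -- integrability of every pairing with `ψ`
  have iT := integrable_inner_of_hasCompactSupport_right hdt hψc hc
  have iC : Integrable (fun x => ⟪convect u u x, ψ x⟫) (volume : Measure E) :=
    integrable_inner_of_hasCompactSupport_right
      ((hu1.continuous_fderiv one_ne_zero).clm_apply huc) hψc hc
  have iL := integrable_inner_of_hasCompactSupport_right (continuous_laplacian hu) hψc hc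
  have iP := integrable_inner_of_hasCompactSupport_right (continuous_gradient_of_contDiff hp)
    hψc hc
  have iF := integrable_inner_of_hasCompactSupport_right hf hψc hc
  have iC' : Integrable (fun x => ⟪u x, convect u ψ x⟫) (volume : Measure E) :=
    integrable_inner_of_hasCompactSupport_right huc
      ((hψ1.continuous_fderiv one_ne_zero).clm_apply huc)
      ((hc.fderiv (𝕜 := ℝ)).mono fun x hx => by
        contrapose! hx; simp only [mem_support, not_not] at hx; simp [convect, hx])
  have iL' : Integrable (fun x => ⟪u x, (Δ ψ) x⟫) (volume : Measure E) :=
    integrable_inner_of_hasCompactSupport_right huc (continuous_laplacian hψ)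
      (hc.mono' fun x hx => by
        contrapose! hx; simp [laplacian_eq_zero_of_notMem_tsupport hx])
  have iD : Integrable (fun x => p x * VectorCalculus.divergence ψ x) (volume : Measure E) := by
    refine (hp.continuous.mul (continuous_divergence (hψ1.continuous_fderiv one_ne_zero)))
      |>.integrable_of_hasCompactSupport ?_
    refine hc.mono' fun x hx => ?_
    contrapose! hx
    simp [divergence_eq_zero_of_notMem_tsupport hx]
  -- integration by parts, term by term
  have eC : ∫ x, ⟪convect u u x, ψ x⟫ = -∫ x, ⟪u x, convect u ψ x⟫ := by
    have h0 := integral_inner_convect_add_eq_zero hu1 hu1 hψ1 hc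
    have hz : ∫ x, VectorCalculus.divergence u x * ⟪u x, ψ x⟫ = 0 := by
      refine integral_eq_zero_of_ae (Eventually.of_forall fun x => ?_)
      by_cases hx : x ∈ tsupport ψ
      · simp [hdiv x hx]
      · simp [image_eq_zero_of_notMem_tsupport hx]
    linarith
  have eL : ∫ x, ⟪(Δ u) x, ψ x⟫ = ∫ x, ⟪u x, (Δ ψ) x⟫ := integral_inner_laplacian_comm hu hψ hc
  have eP : ∫ x, ⟪gradient p x, ψ x⟫ = -∫ x, p x * VectorCalculus.divergence ψ x :=
    integral_inner_gradient_eq_neg_integral_mul_divergence hp hψ1 hc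
  -- assemble
  have key : ∀ x, ⟪dtu x, ψ x⟫ = ⟪f x, ψ x⟫ -
      ⟪convect u u x, ψ x⟫ + ν * ⟪(Δ u) x, ψ x⟫ - ⟪gradient p x, ψ x⟫ := by
    intro x
    rw [hf_eq x]
    simp only [inner_add_left, inner_sub_left, inner_smul_left, RCLike.conj_to_real]
    ring
  have j1 : Integrable (fun x => ⟪f x, ψ x⟫ - ⟪convect u u x, ψ x⟫) (volume : Measure E) :=
    iF.sub iC
  have j2 : Integrable (fun x => ν * ⟪(Δ u) x, ψ x⟫) (volume : Measure E) := iL.const_mul ν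
  have j3 : Integrable (fun x => ⟪f x, ψ x⟫ - ⟪convect u u x, ψ x⟫ + ν * ⟪(Δ u) x, ψ x⟫)
      (volume : Measure E) := j1.add j2
  have j4 : Integrable (fun x => ν * ⟪u x, (Δ ψ) x⟫) (volume : Measure E) := iL'.const_mul ν
  have j5 : Integrable (fun x => ⟪u x, convect u ψ x⟫ + ν * ⟪u x, (Δ ψ) x⟫)
      (volume : Measure E) := iC'.add j4
  have j6 : Integrable (fun x => ⟪u x, convect u ψ x⟫ + ν * ⟪u x, (Δ ψ) x⟫ +
      p x * VectorCalculus.divergence ψ x) (volume : Measure E) := j5.add iD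
  rw [integral_congr_ae (Eventually.of_forall key), integral_sub j3 iP, integral_add j1 j2,
    integral_sub iF iC, integral_const_mul, integral_add j6 iF, integral_add j5 iD,
    integral_add iC' j4, integral_const_mul, eC, eL, eP]
  ring

end Slice

/-! ### Globally smooth fields, divergence free near the support of the test field -/

section Global

variable {E : Type*} [NormedAddCommGroup E] [InnerProductSpace ℝ E] [FiniteDimensional ℝ E]
  [MeasurableSpace E] [BorelSpace E]
variable {Q : Opens (ℝ × E)} {ν : ℝ} {U F : ℝ → E → E} {P : ℝ → E → ℝ}

omit [InnerProductSpace ℝ E] [FiniteDimensional ℝ E] [MeasurableSpace E] [BorelSpace E] in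
/-- A point of the slice support lies under the space–time support. [folklore] -/
theorem mem_tsupport_uncurry_of_mem_tsupport_slice {F' : Type*} [NormedAddCommGroup F']
    {ψ : ℝ → E → F'} {t : ℝ} {x : E} (h : x ∈ tsupport (ψ t)) :
    (t, x) ∈ tsupport (uncurry ψ) :=
  Classical.by_contradiction fun h' => notMem_tsupport_slice_of_notMem h' h

/-- **Weak divergence-free identity for a globally `C¹` field which is divergence free on the
support of the test function**: `∫∫_Q ⟪U, ∇θ⟫ = 0` for every scalar test function `θ` on `Q`
with `div U = 0` on `tsupport θ` (slice by slice
`integral_inner_gradient_eq_zero_of_divergence_eq_zero`, and Fubini as in the tree's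
`isDistributionalNSSolutionOn_of_contDiffOn`). [cite: CaffarelliKohnNirenberg1982, §2 (2.2)] -/
theorem setIntegral_inner_gradient_eq_zero_of_divergence_eq_zero
    (hU : ContDiff ℝ 1 (uncurry U)) {θ : ℝ → E → ℝ} (hθ : IsSpaceTimeTestOn Q θ)
    (hdiv : ∀ z ∈ tsupport (uncurry θ), VectorCalculus.divergence (U z.1) z.2 = 0) :
    ∫ z in (Q : Set (ℝ × E)), ⟪U z.1 z.2, gradient (θ z.1) z.2⟫ = 0 := by
  set K : Set (ℝ × E) := tsupport (uncurry θ) with hK_def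
  have hK : IsCompact K := hθ.hasCompactSupport
  have hKQ : K ⊆ (Q : Set (ℝ × E)) := hθ.tsupport_subset
  have hQ : (Q : Set (ℝ × E)) ⊆ univ ×ˢ univ := by simp
  have hU' : ContDiffOn ℝ 1 (uncurry U) (univ ×ˢ univ) := hU.contDiffOn
  have cu' : ContinuousOn (fun z : ℝ × E => U z.1 z.2) (univ ×ˢ univ) :=
    hU.continuous.continuousOn
  have hG : ContinuousOn (fun z : ℝ × E => ⟪U z.1 z.2, gradient (θ z.1) z.2⟫) (univ ×ˢ univ) :=
    cu'.inner hθ.continuous_slice_gradient.continuousOn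
  have h0 : ∀ z ∉ K, ⟪U z.1 z.2, gradient (θ z.1) z.2⟫ = 0 := fun z hz => by
    rw [gradient_eq_zero_of_notMem_tsupport (notMem_tsupport_slice_of_notMem hz), inner_zero_right]
  rw [setIntegral_eq_integral_integral_of_continuousOn isOpen_univ hK hKQ hQ hG h0]
  refine integral_eq_zero_of_ae (Eventually.of_forall fun t => ?_)
  exact integral_inner_gradient_eq_zero_of_divergence_eq_zero
    (contDiff_slice_of_contDiffOn hU' (mem_univ t))
    ((hθ.contDiff_slice t).of_le (by exact_mod_cast le_top)) (hθ.hasCompactSupport_slice t)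
    fun x hx => hdiv (t, x) (mem_tsupport_uncurry_of_mem_tsupport_slice hx)

/-- **Momentum identity for globally smooth fields which are divergence free on the support of
the test field.** Let `U` be jointly `C²`, `P` jointly `C¹`, `F` jointly continuous on `ℝ × E`,
with `∂ₜU + (U·∇)U = νΔU − ∇P + F` pointwise on `ℝ × E`, and let `ψ` be a vector test field on
`Q` with `div U = 0` on `tsupport ψ`. Then
`∫∫_Q (⟪U, ∂ₜψ⟫ + ⟪U, (U·∇)ψ⟫ + ν⟪U, Δψ⟫ + P div ψ + ⟪F, ψ⟫) = 0` — the momentum part of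
the tree's `isDistributionalNSSolutionOn_of_contDiffOn` on the slab `univ × E`, with the slice
identity replaced by its local form
`integral_inner_dt_test_of_momentum_of_divergence_eq_zero`. [cite: CaffarelliKohnNirenberg1982, §2 (2.2)] -/
theorem setIntegral_momentum_test_eq_zero_of_divergence_eq_zero
    (hU : ContDiff ℝ 2 (uncurry U)) (hP : ContDiff ℝ 1 (uncurry P)) (hF : Continuous (uncurry F))
    (hmom : ∀ t x, timeDeriv U t x + convect (U t) (U t) x =
      ν • (Δ (U t)) x - gradient (P t) x + F t x)
    {ψ : ℝ → E → E} (hψ : IsSpaceTimeTestOn Q ψ)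
    (hdiv : ∀ z ∈ tsupport (uncurry ψ), VectorCalculus.divergence (U z.1) z.2 = 0) :
    ∫ z in (Q : Set (ℝ × E)), (⟪U z.1 z.2, timeDeriv ψ z.1 z.2⟫ +
        ⟪U z.1 z.2, convect (U z.1) (ψ z.1) z.2⟫ + ν * ⟪U z.1 z.2, Δ (ψ z.1) z.2⟫ +
        P z.1 z.2 * VectorCalculus.divergence (ψ z.1) z.2 + ⟪F z.1 z.2, ψ z.1 z.2⟫) = 0 := by
  have hQ : (Q : Set (ℝ × E)) ⊆ univ ×ˢ univ := by simp
  have hu : ContDiffOn ℝ 2 (uncurry U) (univ ×ˢ univ) := hU.contDiffOn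
  have hp : ContDiffOn ℝ 1 (uncurry P) (univ ×ˢ univ) := hP.contDiffOn
  have hu1 : ContDiffOn ℝ 1 (uncurry U) (univ ×ˢ univ) := hu.of_le one_le_two
  have cu' : ContinuousOn (fun z : ℝ × E => U z.1 z.2) (univ ×ˢ univ) :=
    hU.continuous.continuousOn
  have cp : ContinuousOn (fun z : ℝ × E => P z.1 z.2) (univ ×ˢ univ) := hP.continuous.continuousOn
  have cf : ContinuousOn (fun z : ℝ × E => F z.1 z.2) (univ ×ˢ univ) := hF.continuousOn
  have cdt : ContinuousOn (fun z : ℝ × E => timeDeriv U z.1 z.2) (univ ×ˢ univ) :=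
    continuousOn_timeDeriv_of_contDiffOn isOpen_univ hu1
  have hincl : ∀ (t : ℝ) (x : E), (fun y : E => (t, y)) x ∈ (univ : Set ℝ) ×ˢ (univ : Set E) :=
    fun t x => ⟨mem_univ t, mem_univ x⟩
  set K : Set (ℝ × E) := tsupport (uncurry ψ) with hK_def
  have hK : IsCompact K := hψ.hasCompactSupport
  have hKQ : K ⊆ (Q : Set (ℝ × E)) := hψ.tsupport_subset
  have hKS : K ⊆ (univ : Set ℝ) ×ˢ (univ : Set E) := hKQ.trans hQ
  -- vanishing off `K`
  have hψ0 : ∀ z ∉ K, ψ z.1 z.2 = 0 := fun z hz =>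
    (image_eq_zero_of_notMem_tsupport hz : uncurry ψ z = 0)
  have hDψ0 : ∀ z ∉ K, fderiv ℝ (ψ z.1) z.2 = 0 := fun z hz =>
    fderiv_of_notMem_tsupport ℝ (notMem_tsupport_slice_of_notMem hz)
  have hΔψ0 : ∀ z ∉ K, (Δ (ψ z.1)) z.2 = 0 := fun z hz =>
    laplacian_eq_zero_of_notMem_tsupport (notMem_tsupport_slice_of_notMem hz)
  have hdivψ0 : ∀ z ∉ K, VectorCalculus.divergence (ψ z.1) z.2 = 0 := fun z hz =>
    divergence_eq_zero_of_notMem_tsupport (notMem_tsupport_slice_of_notMem hz)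
  have hTψ0 : ∀ z ∉ K, timeDeriv ψ z.1 z.2 = 0 := fun z hz =>
    timeDeriv_eq_zero_off_tsupport hz
  -- the integrand and its continuity
  set G : ℝ × E → ℝ := fun z => ⟪U z.1 z.2, timeDeriv ψ z.1 z.2⟫ +
    ⟪U z.1 z.2, convect (U z.1) (ψ z.1) z.2⟫ + ν * ⟪U z.1 z.2, (Δ (ψ z.1)) z.2⟫ +
    P z.1 z.2 * VectorCalculus.divergence (ψ z.1) z.2 + ⟪F z.1 z.2, ψ z.1 z.2⟫ with hG_def
  have cψ : Continuous fun z : ℝ × E => ψ z.1 z.2 := hψ.contDiff.continuous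
  have cTψ : Continuous fun z : ℝ × E => timeDeriv ψ z.1 z.2 := hψ.continuous_timeDeriv
  have hGc : ContinuousOn G (univ ×ˢ univ) := by
    refine ((((cu'.inner cTψ.continuousOn).add (cu'.inner
      (hψ.continuous_fderiv_slice.continuousOn.clm_apply cu'))).add
      (continuousOn_const.mul (cu'.inner hψ.continuous_laplacian_slice.continuousOn))).add
      (cp.mul hψ.continuous_divergence_slice.continuousOn)).add (cf.inner cψ.continuousOn)
  have hG0 : ∀ z ∉ K, G z = 0 := fun z hz => by
    simp only [hG_def, convect, hψ0 z hz, hDψ0 z hz, hΔψ0 z hz, hdivψ0 z hz, hTψ0 z hz]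
    simp
  change ∫ z in (Q : Set (ℝ × E)), G z = 0
  rw [setIntegral_eq_integral_integral_of_continuousOn isOpen_univ hK hKQ hQ hGc hG0]
  -- the pairing `a = ⟪U, ψ⟫`, `a' = ⟪U, ∂ₜψ⟫ + ⟪∂ₜU, ψ⟫`
  set a : ℝ → E → ℝ := fun s x => ⟪U s x, ψ s x⟫ with ha_def
  set a' : ℝ → E → ℝ := fun s x => ⟪U s x, timeDeriv ψ s x⟫ + ⟪timeDeriv U s x, ψ s x⟫
    with ha'_def
  have hderiv : ∀ s ∈ (univ : Set ℝ), ∀ x, HasDerivAt (fun σ => a σ x) (a' s x) s := by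
    intro s _ x
    have hd := hasDerivAt_timeLine_of_contDiffOn hu1 (isOpen_univ.mem_nhds (mem_univ s)) x
    have h1 := hd.inner ℝ (hψ.hasDerivAt_time s x)
    refine h1.congr_deriv ?_
    simp only [ha'_def]
    rw [show timeDeriv U s x = fderiv ℝ (uncurry U) (s, x) (1, 0) from hd.deriv]
  have ha0 : ∀ z ∉ K, a z.1 z.2 = 0 := fun z hz => by simp [ha_def, hψ0 z hz]
  have ha0' : ∀ z ∉ K, a' z.1 z.2 = 0 := fun z hz => by
    simp only [ha'_def, hψ0 z hz, hTψ0 z hz, inner_zero_right, add_zero]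
  have hcont : ContinuousOn (uncurry a') (univ ×ˢ univ) :=
    (cu'.inner cTψ.continuousOn).add (cdt.inner cψ.continuousOn)
  have key : ∀ t, ∫ x, G (t, x) = ∫ x, a' t x := by
    intro t
    -- slice regularity
    have hu2t : ContDiff ℝ 2 (U t) := contDiff_slice_of_contDiffOn hu (mem_univ t)
    have hp1t : ContDiff ℝ 1 (P t) := contDiff_slice_of_contDiffOn hp (mem_univ t)
    have hdtt : Continuous (timeDeriv U t) :=
      cdt.comp_continuous (Continuous.prodMk_right t) (hincl t)
    have hft : Continuous (F t) := cf.comp_continuous (Continuous.prodMk_right t) (hincl t)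
    have hut : Continuous (U t) := hu2t.continuous
    have hψ2 : ContDiff ℝ 2 (ψ t) := contDiff_infty.1 (hψ.contDiff_slice t) 2
    have hψct : HasCompactSupport (ψ t) := hψ.hasCompactSupport_slice t
    have hslice := integral_inner_dt_test_of_momentum_of_divergence_eq_zero hu2t hp1t hdtt hft
      (hmom t) hψ2 hψct fun x hx => hdiv (t, x) (mem_tsupport_uncurry_of_mem_tsupport_slice hx)
    -- compact `x`-support of the slice integrands
    have hKx : IsCompact (Prod.snd '' K) := hK.image continuous_snd
    have hx0 : ∀ x, x ∉ Prod.snd '' K → (t, x) ∉ K := fun x hx h => hx ⟨(t, x), h, rfl⟩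
    have iT : Integrable (fun x => ⟪U t x, timeDeriv ψ t x⟫) (volume : Measure E) :=
      (hut.inner (cTψ.comp (Continuous.prodMk_right t))).integrable_of_hasCompactSupport
        (HasCompactSupport.intro hKx fun x hx => by
          rw [hTψ0 (t, x) (hx0 x hx), inner_zero_right])
    have iT' : Integrable (fun x => ⟪timeDeriv U t x, ψ t x⟫) (volume : Measure E) :=
      integrable_inner_of_hasCompactSupport_right hdtt hψ2.continuous hψct
    have iR : Integrable (fun x => ⟪U t x, convect (U t) (ψ t) x⟫ +
        ν * ⟪U t x, (Δ (ψ t)) x⟫ + P t x * VectorCalculus.divergence (ψ t) x +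
        ⟪F t x, ψ t x⟫) (volume : Measure E) := by
      refine Continuous.integrable_of_hasCompactSupport ?_
        (HasCompactSupport.intro hKx fun x hx => ?_)
      · exact (((hut.inner (((hψ2.continuous_fderiv two_ne_zero)).clm_apply hut)).add
          (continuous_const.mul (hut.inner (continuous_laplacian hψ2)))).add
          (hp1t.continuous.mul (continuous_divergence
            ((hψ2.of_le one_le_two).continuous_fderiv one_ne_zero)))).add
          (hft.inner hψ2.continuous)
      · have hz := hx0 x hx
        simp only [convect, hDψ0 (t, x) hz, hΔψ0 (t, x) hz, hdivψ0 (t, x) hz, hψ0 (t, x) hz]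
        simp
    have e1 : ∫ x, G (t, x) = (∫ x, ⟪U t x, timeDeriv ψ t x⟫) +
        ∫ x, (⟪U t x, convect (U t) (ψ t) x⟫ + ν * ⟪U t x, (Δ (ψ t)) x⟫ +
          P t x * VectorCalculus.divergence (ψ t) x + ⟪F t x, ψ t x⟫) := by
      rw [← integral_add iT iR]
      refine integral_congr_ae (Eventually.of_forall fun x => ?_)
      simp only [hG_def]
      ring
    have e2 : ∫ x, a' t x = (∫ x, ⟪U t x, timeDeriv ψ t x⟫) + ∫ x, ⟪timeDeriv U t x, ψ t x⟫ := by
      rw [← integral_add iT iT']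
    rw [e1, e2, hslice]
  rw [integral_congr_ae (Eventually.of_forall key)]
  exact integral_integral_eq_zero_of_hasDerivAt_time isOpen_univ hK hKS hderiv ha0 ha0' hcont

end Global

/-! ### Classical solutions on an open region -/

section Region

variable {E : Type*} [NormedAddCommGroup E] [InnerProductSpace ℝ E] [FiniteDimensional ℝ E]
  [MeasurableSpace E] [BorelSpace E]
variable {O : Set (ℝ × E)} {ν : ℝ} {f u : ℝ → E → E} {p : ℝ → E → ℝ}

omit [FiniteDimensional ℝ E] [MeasurableSpace E] [BorelSpace E] in
/-- On an open region, the slice derivative `(t, x) ↦ Dₓ(w t)(x)` of a jointly `Cⁿ` field,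
`n ≥ 1`, is jointly continuous (it is `D(uncurry w)(t, x) ∘ (0, ·)` there). [folklore] -/
theorem continuousOn_fderiv_slice_of_isOpen {F : Type*} [NormedAddCommGroup F] [NormedSpace ℝ F]
    {w : ℝ → E → F} {n : WithTop ℕ∞} (hO : IsOpen O) (hw : ContDiffOn ℝ n (uncurry w) O)
    (hn : 1 ≤ n) : ContinuousOn (fun z : ℝ × E => fderiv ℝ (w z.1) z.2) O := by
  have hD : ContinuousOn (fderiv ℝ (uncurry w)) O := hw.continuousOn_fderiv_of_isOpen hO hn
  have h1 : ContinuousOn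
      (fun z : ℝ × E => (fderiv ℝ (uncurry w) z).comp (ContinuousLinearMap.inr ℝ ℝ E)) O :=
    hD.clm_comp continuousOn_const
  refine h1.congr fun z hz => ?_
  have hd : HasFDerivAt (uncurry w) (fderiv ℝ (uncurry w) z) (z.1, z.2) :=
    ((hw.contDiffAt (hO.mem_nhds hz)).differentiableAt (zero_lt_one.trans_le hn).ne').hasFDerivAt
  exact (hasFDerivAt_slice hd).fderiv

/-- **The classical slice derivative is a weak spatial gradient on an open region.** If
`(u, p)` is a classical solution on an open region `O` (it is only used that `u` is jointly `C¹`
on `O`), then `Dₓu` is a weak spatial gradient of `u` on every open `Q ⊆ O` (CKN 1982, (2.1));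
region form of `hasWeakSpatialGradientOn_of_contDiffOn`, by localisation with a smooth cutoff
`≡ 1` near the support of the test function. [cite: CaffarelliKohnNirenberg1982, §2 (2.1)] -/
theorem IsClassicalNSSolutionOnRegion.hasWeakSpatialGradientOn (hO : IsOpen O)
    (h : IsClassicalNSSolutionOnRegion O ν f u p) {Q : Opens (ℝ × E)}
    (hQ : (Q : Set (ℝ × E)) ⊆ O) :
    HasWeakSpatialGradientOn Q u fun t x => fderiv ℝ (u t) x where
  locallyIntegrableOn :=
    (h.smooth_velocity.continuousOn.mono hQ).locallyIntegrableOn Q.isOpen.measurableSet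
  locallyIntegrableOn_grad :=
    ((continuousOn_fderiv_slice_of_isOpen hO h.smooth_velocity (by exact_mod_cast le_top)).mono
      hQ).locallyIntegrableOn Q.isOpen.measurableSet
  integral_fderiv_mul_inner_eq φ hφ v w := by
    obtain ⟨χ, hχ, -, hχO, hχ1⟩ := exists_contDiff_tsupport_subset_eventuallyEq_one
      (X := ℝ × E) hφ.hasCompactSupport hO (hφ.tsupport_subset.trans hQ)
    set U : ℝ → E → E := fun t x => χ (t, x) • u t x with hU_def
    have hU1 : ContDiff ℝ 1 (uncurry U) := by
      rw [hU_def, uncurry_cutoff_smul]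
      exact contDiff_cutoff_smul_of_contDiffOn hO (hχ.of_le (by exact_mod_cast le_top)) hχO
        (h.smooth_velocity.of_le (by exact_mod_cast le_top))
    have hW := subset_interior_setOf_eq_one hχ1
    have key := (hasWeakSpatialGradientOn_of_contDiffOn isOpen_univ (Q := Q) (u := U)
      (by simp) hU1.contDiffOn).integral_fderiv_mul_inner_eq φ hφ v w
    have e1 : ∀ t x, fderiv ℝ (φ t) x v * ⟪U t x, w⟫ = fderiv ℝ (φ t) x v * ⟪u t x, w⟫ := by
      intro t x
      by_cases hz : (t, x) ∈ tsupport (uncurry φ)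
      · have hmem : (t, x) ∈ {w : ℝ × E | χ w = 1} := interior_subset (hW hz)
        have hχz : χ (t, x) = 1 := hmem
        simp [hU_def, hχz]
      · rw [fderiv_of_notMem_tsupport ℝ (notMem_tsupport_slice_of_notMem hz)]
        simp
    have e2 : ∀ t x, φ t x * ⟪fderiv ℝ (U t) x v, w⟫ = φ t x * ⟪fderiv ℝ (u t) x v, w⟫ := by
      intro t x
      by_cases hz : (t, x) ∈ tsupport (uncurry φ)
      · have hgerm : uncurry U =ᶠ[𝓝 (t, x)] uncurry u := by
          rw [hU_def, uncurry_cutoff_smul]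
          exact smul_eventuallyEq_of_mem_interior (hW hz)
        rw [fderiv_slice_congr_of_eventuallyEq hgerm]
      · have h0 : φ t x = 0 := (image_eq_zero_of_notMem_tsupport hz : uncurry φ (t, x) = 0)
        simp [h0]
    simp only [e1, e2] at key
    exact key

/-- **Classical solutions on an open space–time region are distributional solutions.** Let
`(u, p)` be a classical solution of the Navier–Stokes system with viscosity `ν` and force `f` on
an open region `O ⊆ ℝ × E` (`IsClassicalNSSolutionOnRegion`: fields smooth on `O`, equations
pointwise on `O`; the force is then automatically continuous on `O`). Then `(u, p)` solves the
system in the sense of distributions (`IsDistributionalNSSolutionOn`, CKN 1982, (2.2)) on every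
open `Q ⊆ O`.
Region form of `isDistributionalNSSolutionOn_of_contDiffOn` (fields smooth on a slab), by
localisation: for a test field `ψ` on `Q`, a smooth cutoff `χ ≡ 1` near `tsupport ψ` supported
in `O` gives globally smooth compactly supported `ũ = χu`, `p̃ = χp`, with the germs of `u`,
`p` along `tsupport ψ`; they solve the system on `ℝ × E` with the continuous residual force
`f̃ = ∂ₜũ + (ũ·∇)ũ − νΔũ + ∇p̃` (`= f` on `tsupport ψ`) and are divergence free on `tsupport ψ`,
so `setIntegral_momentum_test_eq_zero_of_divergence_eq_zero` applies, and the weak integrands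
of `(u, p, f)` and `(ũ, p̃, f̃)` against `ψ` coincide pointwise. [cite: CaffarelliKohnNirenberg1982, §2 (2.2)] -/
theorem IsClassicalNSSolutionOnRegion.isDistributionalNSSolutionOn (hO : IsOpen O)
    (h : IsClassicalNSSolutionOnRegion O ν f u p) {Q : Opens (ℝ × E)}
    (hQ : (Q : Set (ℝ × E)) ⊆ O) :
    IsDistributionalNSSolutionOn Q ν f u p := by
  have cu : ContinuousOn (uncurry u) O := h.smooth_velocity.continuousOn
  have cp : ContinuousOn (uncurry p) O := h.smooth_pressure.continuousOn
  refine ⟨(cu.mono hQ).locallyIntegrableOn Q.isOpen.measurableSet,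
    ((cu.norm.pow 2).mono hQ).locallyIntegrableOn Q.isOpen.measurableSet,
    (cp.mono hQ).locallyIntegrableOn Q.isOpen.measurableSet, ?_, ?_⟩
  · -- `div u = 0` weakly
    intro θ hθ
    obtain ⟨χ, hχ, -, hχO, hχ1⟩ := exists_contDiff_tsupport_subset_eventuallyEq_one
      (X := ℝ × E) hθ.hasCompactSupport hO (hθ.tsupport_subset.trans hQ)
    set U : ℝ → E → E := fun t x => χ (t, x) • u t x with hU_def
    have hU1 : ContDiff ℝ 1 (uncurry U) := by
      rw [hU_def, uncurry_cutoff_smul]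
      exact contDiff_cutoff_smul_of_contDiffOn hO (hχ.of_le (by exact_mod_cast le_top)) hχO
        (h.smooth_velocity.of_le (by exact_mod_cast le_top))
    have hW := subset_interior_setOf_eq_one hχ1
    have e : ∀ z : ℝ × E, ⟪u z.1 z.2, gradient (θ z.1) z.2⟫ = ⟪U z.1 z.2, gradient (θ z.1) z.2⟫ := by
      intro z
      by_cases hz : z ∈ tsupport (uncurry θ)
      · have hmem : z ∈ {w : ℝ × E | χ w = 1} := interior_subset (hW hz)
        have hχz : χ (z.1, z.2) = 1 := hmem
        simp [hU_def, hχz]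
      · rw [gradient_eq_zero_of_notMem_tsupport (notMem_tsupport_slice_of_notMem hz)]
        simp
    rw [setIntegral_congr_fun Q.isOpen.measurableSet fun z _ => e z]
    refine setIntegral_inner_gradient_eq_zero_of_divergence_eq_zero hU1 hθ fun z hz => ?_
    have hgerm : uncurry U =ᶠ[𝓝 (z.1, z.2)] uncurry u := by
      rw [hU_def, uncurry_cutoff_smul]
      exact smul_eventuallyEq_of_mem_interior (hW hz)
    rw [VectorCalculus.divergence, fderiv_slice_congr_of_eventuallyEq hgerm]
    exact h.divFree z.1 z.2 (hQ (hθ.tsupport_subset hz))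
  · -- the momentum equation
    intro ψ hψ
    set K : Set (ℝ × E) := tsupport (uncurry ψ) with hK_def
    obtain ⟨χ, hχ, hχc, hχO, hχ1⟩ := exists_contDiff_tsupport_subset_eventuallyEq_one
      (X := ℝ × E) hψ.hasCompactSupport hO (hψ.tsupport_subset.trans hQ)
    set U : ℝ → E → E := fun t x => χ (t, x) • u t x with hU_def
    set P : ℝ → E → ℝ := fun t x => χ (t, x) • p t x with hP_def
    have hUs : ContDiff ℝ ∞ (uncurry U) := by
      rw [hU_def, uncurry_cutoff_smul]
      exact contDiff_cutoff_smul_of_contDiffOn hO hχ hχO h.smooth_velocity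
    have hPs : ContDiff ℝ ∞ (uncurry P) := by
      rw [hP_def, uncurry_cutoff_smul]
      exact contDiff_cutoff_smul_of_contDiffOn hO hχ hχO h.smooth_pressure
    have hUt : IsSpaceTimeTestOn (⊤ : Opens (ℝ × E)) U := by
      refine ⟨hUs, ?_, by simp⟩
      rw [hU_def, uncurry_cutoff_smul]
      exact hχc.smul_right
    have hPt : IsSpaceTimeTestOn (⊤ : Opens (ℝ × E)) P := by
      refine ⟨hPs, ?_, by simp⟩
      rw [hP_def, uncurry_cutoff_smul]
      exact hχc.smul_right
    have hU2 : ContDiff ℝ 2 (uncurry U) := hUs.of_le (WithTop.coe_le_coe.2 le_top)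
    have hP1 : ContDiff ℝ 1 (uncurry P) := hPs.of_le (WithTop.coe_le_coe.2 le_top)
    -- the residual force of the localised pair
    set F : ℝ → E → E := fun t x =>
      timeDeriv U t x + convect (U t) (U t) x - ν • (Δ (U t)) x + gradient (P t) x with hF_def
    have hF : Continuous (uncurry F) := by
      have c1 : Continuous fun z : ℝ × E => timeDeriv U z.1 z.2 := hUt.continuous_timeDeriv
      have c2 : Continuous fun z : ℝ × E => convect (U z.1) (U z.1) z.2 :=
        hUt.continuous_fderiv_slice.clm_apply hUs.continuous
      have c3 : Continuous fun z : ℝ × E => (Δ (U z.1)) z.2 := hUt.continuous_laplacian_slice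
      have c4 : Continuous fun z : ℝ × E => gradient (P z.1) z.2 := hPt.continuous_slice_gradient
      exact ((c1.add c2).sub (c3.const_smul ν)).add c4
    have hmom : ∀ t x, timeDeriv U t x + convect (U t) (U t) x =
        ν • (Δ (U t)) x - gradient (P t) x + F t x := by
      intro t x
      simp only [hF_def]
      abel
    have hW := subset_interior_setOf_eq_one hχ1
    have hgermU : ∀ z ∈ K, uncurry U =ᶠ[𝓝 (z.1, z.2)] uncurry u := fun z hz => by
      rw [hU_def, uncurry_cutoff_smul]
      exact smul_eventuallyEq_of_mem_interior (hW hz)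
    have hgermP : ∀ z ∈ K, uncurry P =ᶠ[𝓝 (z.1, z.2)] uncurry p := fun z hz => by
      rw [hP_def, uncurry_cutoff_smul]
      exact smul_eventuallyEq_of_mem_interior (hW hz)
    -- `div U = 0` on `K`
    have hdivK : ∀ z ∈ K, VectorCalculus.divergence (U z.1) z.2 = 0 := fun z hz => by
      rw [VectorCalculus.divergence, fderiv_slice_congr_of_eventuallyEq (hgermU z hz)]
      exact h.divFree z.1 z.2 (hQ (hψ.tsupport_subset hz))
    have key := setIntegral_momentum_test_eq_zero_of_divergence_eq_zero hU2 hP1 hF hmom hψ hdivK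
    -- vanishing of the test-field factors off `K`
    have hψ0 : ∀ z ∉ K, ψ z.1 z.2 = 0 := fun z hz =>
      (image_eq_zero_of_notMem_tsupport hz : uncurry ψ z = 0)
    have hDψ0 : ∀ z ∉ K, fderiv ℝ (ψ z.1) z.2 = 0 := fun z hz =>
      fderiv_of_notMem_tsupport ℝ (notMem_tsupport_slice_of_notMem hz)
    have hΔψ0 : ∀ z ∉ K, (Δ (ψ z.1)) z.2 = 0 := fun z hz =>
      laplacian_eq_zero_of_notMem_tsupport (notMem_tsupport_slice_of_notMem hz)
    have hdivψ0 : ∀ z ∉ K, VectorCalculus.divergence (ψ z.1) z.2 = 0 := fun z hz =>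
      divergence_eq_zero_of_notMem_tsupport (notMem_tsupport_slice_of_notMem hz)
    have hTψ0 : ∀ z ∉ K, timeDeriv ψ z.1 z.2 = 0 := fun z hz =>
      timeDeriv_eq_zero_off_tsupport hz
    -- the weak integrands of `(u, p, f)` and `(U, P, F)` coincide
    have e : ∀ z : ℝ × E,
        ⟪u z.1 z.2, timeDeriv ψ z.1 z.2⟫ + ⟪u z.1 z.2, convect (u z.1) (ψ z.1) z.2⟫ +
          ν * ⟪u z.1 z.2, Δ (ψ z.1) z.2⟫ + p z.1 z.2 * VectorCalculus.divergence (ψ z.1) z.2 +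
          ⟪f z.1 z.2, ψ z.1 z.2⟫ =
        ⟪U z.1 z.2, timeDeriv ψ z.1 z.2⟫ + ⟪U z.1 z.2, convect (U z.1) (ψ z.1) z.2⟫ +
          ν * ⟪U z.1 z.2, Δ (ψ z.1) z.2⟫ + P z.1 z.2 * VectorCalculus.divergence (ψ z.1) z.2 +
          ⟪F z.1 z.2, ψ z.1 z.2⟫ := by
      intro z
      by_cases hz : z ∈ K
      · have hmem : z ∈ {w : ℝ × E | χ w = 1} := interior_subset (hW hz)
        have hχz : χ (z.1, z.2) = 1 := hmem
        have hUval : U z.1 z.2 = u z.1 z.2 := by simp [hU_def, hχz]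
        have hPval : P z.1 z.2 = p z.1 z.2 := by simp [hP_def, hχz]
        have hzO : (z.1, z.2) ∈ O := hQ (hψ.tsupport_subset hz)
        have hFz : F z.1 z.2 = f z.1 z.2 := by
          have hm := h.momentum_deriv hO hzO
          have hT : timeDeriv U z.1 z.2 = deriv (fun s => u s z.2) z.1 := by
            rw [timeDeriv_congr_of_eventuallyEq (hgermU z hz), timeDeriv_apply]
          have hC : convect (U z.1) (U z.1) z.2 = convect (u z.1) (u z.1) z.2 := by
            simp only [convect, fderiv_slice_congr_of_eventuallyEq (hgermU z hz), hUval]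
          have hL : (Δ (U z.1)) z.2 = (Δ (u z.1)) z.2 :=
            (InnerProductSpace.laplacian_congr_nhds
              (eventuallyEq_slice_of_eventuallyEq_uncurry (hgermU z hz))).eq_of_nhds
          have hG : gradient (P z.1) z.2 = gradient (p z.1) z.2 := by
            simp only [gradient, fderiv_slice_congr_of_eventuallyEq (hgermP z hz)]
          simp only [hF_def, hT, hC, hL, hG]
          rw [hm]
          abel
        simp only [convect, hUval, hPval, hFz]
      · simp only [convect, hψ0 z hz, hDψ0 z hz, hΔψ0 z hz, hdivψ0 z hz, hTψ0 z hz]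
        simp
    rw [setIntegral_congr_fun Q.isOpen.measurableSet fun z _ => e z]
    exact key

end Region

end Literature.Analysis.FluidPDE

end
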